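import Summits.QuantumFields.BalabanUV.T4Continuum.Support.OutputRateTowerBalabanRate
import Summits.QuantumFields.BalabanUV.T4Continuum.Support.OutputRateArithmetic

/-!
# OutputRateTowerArithmetic — the TOWER-READING ROAD's END faces of row NE5 with the arithmetic letters `k₀, B, k₁, ρ₁`
# ELIMINATED (one strict reach inequality `c·(EA₀ + E₀)/(1 − ω) < ρ₀` replaces them, sharply) and the `∃ C₅`-outermost face
# (cell `pub-balaban`, T⁴ fan-out, row NE5 of `HOME/BINDER-OWNERS.md`; NE5 swarm, claim-table row O6-n NUMERICS, lineage follower #3;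
# unit `b2b-balaban-t4-ne5-formalise-leaf-10`; LEAN PLACEMENT RULE 2026-08-19: our bookkeeping lives under `Summits/`)

HONEST FRAMING (T4-DAG PAGE 1).  The cell's T⁴ target is rung (B)+1: existence AND uniqueness of the ε → 0 limit of Bałaban's
unit-scale gauge-invariant expectations on a FIXED finite torus T⁴ — NOT infinite volume, NOT a mass gap, NOT the Clay problem.
The spine estimate NE5 (`T4OutputRate.NE5`) is NOT PRINTED in the audited series (cell GAPS G-t4-U3-1) and is NOT PROVED here:
this module is real arithmetic over the DISPLAYED binders of LANDED END faces of the tower-reading road (`OutputRateTowerSocket`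
p203601∕p203797 and `OutputRateTowerInstance` p205877 — owner lineage t4-ne5-p1; `OutputRateTowerBalaban` p213906 — NE2 crew leaf-08;
`OutputRateTowerBalabanRate` p219950 — owner g33), each APPLIED BY NAME, never re-wired.  Nothing printed is asserted; 0 cite tags;
no «…» quotation is introduced; no `def … : Prop` is minted.  Spine estimates PROVED: 0/9, unchanged; leaves instantiated on
Bałaban's concrete objects: 0/12, unchanged (row O1 = the substrate cell).  HONEST DEPENDENCY (cell, verbatim): continuum YM on
T⁴ ⇐ BetaPertH ∧ nine spine estimates (0/9 proved); BetaPertH ⇐ (D1) ∧ (D4) ∧ CAP+tail; G-an2-4 gates asym, D1 and NE2/3/4.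

WHAT IS ELIMINATED, AND WHAT IS NOT.  On this road W1 is row NE2's tower law (+ row NE3's `LocalRate` in the minimiser split) and
W4 is PRODUCED from W1 by `OutputRateInsertion.insertionRate_of_operatorRate`, so every END face carries the ARITHMETIC letters `k₀`
(reach scale), `B` (first scales), `k₁, ρ₁` (the insertion species' reach) with the binders `hρ₁ : ρ₁ < 1`, `hreach : δ·θ^{k₁} ≤ ρ₁`,
`hnear : (δ + (Gi·δ/(1 − ρ₁) + 2Gi/θ^{k₁}))·θ^{k₀} + c(EA₀ + E₀)/(1 − ω) ≤ ρ₀`, `hB : 0 ≤ B`, `hfirst : ∀ k < k₀, EA₀ + E₀ ≤ B·θ^k`.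
Here `ρ₀` is the ANALYTIC radius of the W2 binder `DataLipschitz W κ Λ ρ₀` and `Λ` its modulus: both STAY displayed (on the
END-of-record road `Λ = G/(1 − ρ₀)` made `ρ₀` eliminable — `B13StepEndArithmetic.arithmetic_letters_iff`).  What goes is
`k₀, B, k₁, ρ₁` with their five binders, replaced by `0 < θ < 1` and the ONE strict inequality `c·(EA₀ + E₀)/(1 − ω) < ρ₀`
("the fed-back one-run level is strictly inside the Lipschitz radius") — and NECESSARILY so (`tower_letters_iff`, sharp).

## What is PROVED (kernel; Mathlib + the two imports; no `sorry`, no new axiom)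

§0 `insReach_exists_any`, `reach_binders_exists_any`: the letter witnesses WITHOUT sign hypotheses on `δ`, `D` (for `D < 0` the
   scale `k₀ = 0` serves); `tower_letters_iff`: for a genuine insertion species (`Gi > 0`, `δ ≥ 0`, `0 < θ < 1`) the four
   letters with their five binders EXIST IFF `c·(EA₀ + E₀)/(1 − ω) < ρ₀` (`OutputRateArithmetic.reach_necessary` BY NAME).
§1 SOCKET (generic `StepModel`, `J`-indexed tower families): `exists_ne5_at_of_towerLaw_{lip,split}_readsIns_nat` — the two
   socket END faces with W4 produced, letters eliminated, conclusion `∃ C₅, NE5 EA EB W κ θ′ C₅` at the PRESCRIBED rate `θ′`;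
   `exists_rate_ne5_of_towerLaw_split_readsIns_nat` — the smallness `ω + Λ·c < θ′` replaced by the ROOM `ω + Λ·c < 1` as well
   (`OutputRateArithmetic.rate_window_iff`) ⟹ `∃ θ′ ∈ [θ, 1), ∃ C₅, NE5 …`.
§2 `uniform_ne5_of_towerLaw_split_readsIns`: the `∃ C₅`-OUTERMOST face — fix the SIZES `κ, Λ, ρ₀, EA₀, E₀, Gi, δ, c, ω, θ, θ′`
   subject to `c(EA₀ + E₀)/(1 − ω) < ρ₀` and `ω + Λ·c < θ′`; then ONE constant serves EVERY carrier structure, step model, insertion,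
   tower family (any index type), reading, intermediate family, distance, `Readings` carrier, pair of functionals and window whose
   displayed binders hold with those sizes (W1's constant pinned by `cR·Cop/r₀ + Λb·Cm = δ`): the quantifier order `∃ C₅, ∀ …`.
§3 INSTANCES, one application each: `exists_ne5_at_of_perturbed_split_readsIns_nat` (row NE2's perturbed free towers, the
   trigger's tower END of record), `exists_ne5_at_of_balaban_lip_readsIns_nat` (Bałaban's typed tier-B operator, rate `L⁻¹`) and
   `exists_ne5_at_of_balaban_split_readsIns_ne3Shape_nat` (the owner's g33 END, p219950: minimiser split, node U1b's FULL `NE3Shape`,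
   NO rate binder, rate `max θ L⁻¹`); the last two need `1 < L` (rate `< 1`) — the printed «L odd > 11», not the faces' `[NeZero L]`.

NOT COVERED (one application of §1 each; file budget): `OutputRateTowerInstanceCovariant…`, the planted class, the other rate-`θ`
faces of `OutputRateTowerBalabanRate`; the W4-DISPLAYED socket faces reduce by `OutputRateArithmetic.exists_ne5_at_of_stepModel_lip_nat_reach`.
No letter is given a value.  Provenance: NE5 swarm seat leaf-10 (gen 7), 2026-08-20; census `HOME/t4/…-leaf-10/B13SmallnessCensus.md` §11.
-/

noncomputable section

open Set Metric
open scoped Matrix Matrix.Norms.L2Operator Kronecker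

namespace Summit.QuantumFields.BalabanUV.T4Continuum.OutputRateTowerArithmetic

open Literature.MathematicalPhysics.QuantumFieldTheory.Balaban1983to89
open Literature.MathematicalPhysics.QuantumFieldTheory.Balaban1983to89.T4OutputRate
open Literature.MathematicalPhysics.QuantumFieldTheory.Balaban1983to89.T4InputCauchyRate
open Literature.MathematicalPhysics.QuantumFieldTheory.Balaban1983to89.T4InputCauchyRateData
open Literature.MathematicalPhysics.QuantumFieldTheory.Balaban1983to89.T4OperatorRateLiaison
open Literature.MathematicalPhysics.QuantumFieldTheory.Balaban1983to89.T4EtaRateMin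
open Summit.QuantumFields.BalabanUV.T4Continuum.CovariantAveragingTower
open Summit.QuantumFields.BalabanUV.T4Continuum.BackgroundResolventTower
open Summit.QuantumFields.BalabanUV.T4Continuum.OutputRateInsertion
open Summit.QuantumFields.BalabanUV.T4Continuum.OutputRateTowerSocket
open Summit.QuantumFields.BalabanUV.T4Continuum.OutputRateTowerInstance
open Summit.QuantumFields.BalabanUV.T4Continuum.OutputRateTowerBalaban
open Summit.QuantumFields.BalabanUV.T4Continuum.OutputRateArithmetic

/-! ## §0 The letter witnesses without sign hypotheses -/

section Letters

/-- [folklore] The insertion species' reach letter at `ρ₁ = ½`, for ANY real `δ` (no sign needed): if `θ < 1` some `k₁` has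
`δ·θ^{k₁} ≤ ½` (`δ ≤ 0`: `k₁ = 0`; `δ > 0`: `OutputRateArithmetic.reach_scale_exists`). -/
theorem insReach_exists_any {δ θ : ℝ} (hθ1 : θ < 1) : ∃ k₁ : ℕ, δ * θ ^ k₁ ≤ 1 / 2 := by
  rcases le_or_gt δ 0 with hδ | hδ
  · exact ⟨0, by rw [pow_zero, mul_one]; linarith⟩
  · obtain ⟨k₁, hk₁⟩ := reach_scale_exists (h := 0) (ρ₀ := 1 / 2) hδ.le hθ1 (by norm_num)
    exact ⟨k₁, by simpa using hk₁⟩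

/-- [folklore] **THE THREE L10 LETTERS AT ONCE, FOR ANY REAL INPUT-RATE CONSTANT `D`** (no sign needed): from `0 < θ < 1` and the
strict reach `c(EA₀ + E₀)/(1 − ω) < ρ₀`, a scale `k₀` and a constant `B ≥ 0` with the near hypothesis
`D·θ^{k₀} + c(EA₀ + E₀)/(1 − ω) ≤ ρ₀` and the first scales `EA₀ + E₀ ≤ B·θ^k (k < k₀)` — `OutputRateArithmetic.reach_binders_exists`
for `D ≥ 0`, and `k₀ = 0`, `B = 0` for `D < 0`. -/
theorem reach_binders_exists_any {D θ c ω ρ₀ EA₀ E₀ : ℝ} (hθ0 : 0 < θ) (hθ1 : θ < 1)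
    (hreach : c * (EA₀ + E₀) / (1 - ω) < ρ₀) :
    ∃ k₀ : ℕ, ∃ B : ℝ, 0 ≤ B ∧ D * θ ^ k₀ + c * (EA₀ + E₀) / (1 - ω) ≤ ρ₀ ∧ ∀ k < k₀, EA₀ + E₀ ≤ B * θ ^ k := by
  rcases le_or_gt 0 D with hD | hD
  · exact reach_binders_exists hD hθ0 hθ1 hreach
  · exact ⟨0, 0, le_rfl, by rw [pow_zero, mul_one]; linarith, fun k hk => absurd hk (Nat.not_lt_zero k)⟩

/-- [folklore] **THE TOWER ROAD's FOUR ARITHMETIC LETTERS WITH THEIR FIVE BINDERS ARE JOINTLY SATISFIABLE IFF THE ONE STRICT REACH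
HOLDS** (sharp; a genuine insertion species `Gi > 0`, `δ ≥ 0`, input rate `0 < θ < 1`): the binders are LITERALLY `hρ₁`, `hreach`,
`hnear`, `hB`, `hfirst` of `OutputRateTowerSocket.ne5_at_of_towerLaw_split_readsIns_nat`; «⇒» is `OutputRateArithmetic.reach_necessary`
(`D = δ + Gi·δ/(1 − ρ₁) + 2Gi/θ^{k₁} > 0`), «⇐» the two witnesses above with `ρ₁ := ½`. -/
theorem tower_letters_iff {δ Gi θ c ω ρ₀ EA₀ E₀ : ℝ} (hGi : 0 < Gi) (hδ : 0 ≤ δ) (hθ0 : 0 < θ) (hθ1 : θ < 1) :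
    (∃ ρ₁ : ℝ, ∃ k₁ k₀ : ℕ, ∃ B : ℝ, ρ₁ < 1 ∧ δ * θ ^ k₁ ≤ ρ₁ ∧
        (δ + (Gi * δ / (1 - ρ₁) + 2 * Gi / θ ^ k₁)) * θ ^ k₀ + c * (EA₀ + E₀) / (1 - ω) ≤ ρ₀ ∧ 0 ≤ B ∧
        ∀ k < k₀, EA₀ + E₀ ≤ B * θ ^ k) ↔ c * (EA₀ + E₀) / (1 - ω) < ρ₀ := by
  refine ⟨fun ⟨ρ₁, k₁, k₀, B, hρ₁, _, hnear, _, _⟩ => reach_necessary ?_ hθ0 hnear, fun h => ?_⟩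
  · have h1 : 0 < 1 - ρ₁ := by linarith
    have h2 : 0 < 2 * Gi / θ ^ k₁ := div_pos (by linarith) (pow_pos hθ0 k₁)
    have h3 : 0 ≤ Gi * δ / (1 - ρ₁) := div_nonneg (mul_nonneg hGi.le hδ) h1.le
    linarith
  · obtain ⟨k₁, hk₁⟩ := insReach_exists_any (δ := δ) hθ1
    obtain ⟨k₀, B, hB, hnear, hfirst⟩ :=
      reach_binders_exists_any (D := δ + (Gi * δ / (1 - 1 / 2) + 2 * Gi / θ ^ k₁)) hθ0 hθ1 h
    exact ⟨1 / 2, k₁, k₀, B, by norm_num, hk₁, hnear, hB, hfirst⟩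

end Letters

/-! ## §1 The SOCKET END faces (generic step model, `J`-indexed tower families) with the letters eliminated -/

section Socket

variable {J : Type*} {ι : J → ℕ → Type*} [∀ j k, Fintype (ι j k)] [∀ j k, DecidableEq (ι j k)]
variable {C : Carriers} {Op Hist : Type*} [NormedAddCommGroup Op] [NormedSpace ℂ Op] [NormedAddCommGroup Hist]
  [NormedSpace ℂ Hist] [CompleteSpace Hist] (M : StepModel C Op Hist)

/-- [folklore] **THE SOCKET END WITH W4 PRODUCED, ARITHMETIC LETTERS ELIMINATED** — `OutputRateTowerSocket.ne5_at_of_towerLaw_lip_readsIns_nat`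
(W1 := row NE2's tower law read by `ReadsTower`, W4 produced from the same W1) with `k₀, B, k₁, ρ₁` and the binders `hρ₁`, `hreach`,
`hnear`, `hB`, `hfirst` REPLACED by `0 < θ < 1` and the strict reach `c(EA₀ + E₀)/(1 − ω) < ρ₀`; every analytic binder BY NAME and
unchanged (NE2 `hr`∕`hA`∕`hlaw`, reading `hread` + floor, MI-R, W2 `hlip`, levels, `ReadsIns` ∧ `InsOpEnvelope` ∧ `InsBoundA`, W3 as
`InsertionDampedNat`, S `hsmall`).  Conclusion: NE5 at the PRESCRIBED rate `θ′` with SOME constant.  NOT a proof of NE5. -/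
theorem exists_ne5_at_of_towerLaw_lip_readsIns_nat (Ins : ℕ → Op → (C.Dom → ℝ) → Hist)
    {A : (j : J) → (k : ℕ) → Matrix (ι j k) (ι j (k + 1)) ℂ} {X : (j : J) → (k : ℕ) → Matrix (ι j k) (ι j k) ℂ}
    {r Cop cR r₀ : ℝ} {tow : ℕ → (ℕ → ℝ) → C.BgB → J} {EA : Functional C C.BgA} {EB : Functional C C.BgB}
    {W : Set (ℕ → ℝ)} {κ Λ EA₀ E₀ Gi θ θ' c ω ρ₀ : ℝ} (hr : 0 < r) (hA : TowerContracting A r)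
    (hlaw : TowerLaw A X r Cop θ) (hread : ReadsTower M A X r W cR tow) (hcR : 0 ≤ cR) (hCop : 0 ≤ Cop)
    (hfl : ∀ k, r₀ ≤ M.rOp k) (hr₀ : 0 < r₀) (hrA : M.RepresentsA EA W) (hrB : M.RepresentsB EB W)
    (hbase : M.InBase EB W) (hlip : M.DataLipschitz W κ Λ ρ₀) (hdA : DecayBound EA W EA₀ κ) (hdB : DecayBound EB W E₀ κ)
    (hreadI : (InsOpModel.ofStep M Ins).ReadsIns W) (hienv : (InsOpModel.ofStep M Ins).InsOpEnvelope W κ E₀ Gi)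
    (hbdA : (InsOpModel.ofStep M Ins).InsBoundA W κ E₀ Gi) (hGi : 0 ≤ Gi) (hdamp : M.InsertionDampedNat W κ c ω)
    (hΛ : 0 ≤ Λ) (hθ0 : 0 < θ) (hθ1 : θ < 1) (hθθ' : θ ≤ θ') (hθ'1 : θ' ≤ 1) (hc : 0 ≤ c) (hω : 0 < ω)
    (hreachρ : c * (EA₀ + E₀) / (1 - ω) < ρ₀) (hsmall : ω + Λ * c < θ') : ∃ C₅, NE5 EA EB W κ θ' C₅ := by
  obtain ⟨k₁, hk₁⟩ := insReach_exists_any (δ := cR * Cop / r₀) hθ1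
  obtain ⟨k₀, B, hB, hnear, hfirst⟩ :=
    reach_binders_exists_any (D := cR * Cop / r₀ + (Gi * (cR * Cop / r₀) / (1 - 1 / 2) + 2 * Gi / θ ^ k₁)) hθ0 hθ1 hreachρ
  exact ⟨_, ne5_at_of_towerLaw_lip_readsIns_nat M Ins hr hA hlaw hread hcR hCop hfl hr₀ hrA hrB hbase hlip hdA hdB hreadI
    hienv hbdA hGi (by norm_num) hk₁ hdamp hΛ hθ0 hθθ' hθ'1 hc hω hnear hB hfirst hsmall⟩

/-- [folklore] **THE SOCKET END OF THE MINIMISER SPLIT WITH W4 PRODUCED, ARITHMETIC LETTERS ELIMINATED** —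
`OutputRateTowerSocket.ne5_at_of_towerLaw_split_readsIns_nat` (W1 := row NE2's law on the pair (run A, `opMid`) at a rate `θ₂ ≤ θ`
+ background-Lipschitz × row NE3's `LocalRate R Cm θ`; `hδ : cR·Cop/r₀ + Λb·Cm = δ`; W4 produced) with `k₀, B, k₁, ρ₁` and their five
binders REPLACED by `0 < θ < 1` and `c(EA₀ + E₀)/(1 − ω) < ρ₀`; every analytic binder BY NAME and unchanged.  NOT a proof of NE5. -/
theorem exists_ne5_at_of_towerLaw_split_readsIns_nat (Ins : ℕ → Op → (C.Dom → ℝ) → Hist)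
    {A : (j : J) → (k : ℕ) → Matrix (ι j k) (ι j (k + 1)) ℂ} {X : (j : J) → (k : ℕ) → Matrix (ι j k) (ι j k) ℂ}
    {r Cop θ₂ cR r₀ Λb Cm δ : ℝ} {tow : ℕ → (ℕ → ℝ) → C.BgB → J} (opMid : (ℕ → ℝ) → C.BgB → ℕ → Op)
    (dist : ℕ → (ℕ → ℝ) → C.BgB → ℝ) {ιR XR : Type*} (R : Readings ιR XR) {EA : Functional C C.BgA}
    {EB : Functional C C.BgB} {W : Set (ℕ → ℝ)} {κ Λ EA₀ E₀ Gi θ θ' c ω ρ₀ : ℝ} (hr : 0 < r)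
    (hA : TowerContracting A r) (hlaw : TowerLaw A X r Cop θ₂) (hread : ReadsTowerMid M A X r W cR tow opMid)
    (hcR : 0 ≤ cR) (hCop : 0 ≤ Cop) (hθ₂ : 0 ≤ θ₂) (hθ₂θ : θ₂ ≤ θ) (hfl : ∀ k, r₀ ≤ M.rOp k) (hr₀ : 0 < r₀)
    (hLip : ∀ k, ∀ g ∈ W, ∀ (U : C.BgB), ‖opMid g U k - M.opB g U k‖ ≤ Λb * dist k g U * M.rOp k) (hΛb : 0 ≤ Λb)
    (hR : LocalRate R Cm θ) (hCm : 0 ≤ Cm)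
    (hdom : ∀ k, ∀ g ∈ W, ∀ (U : C.BgB), ∃ V ∈ R.dom, ∃ x : XR, dist k g U ≤ |R.loc (k + 1) V x - R.loc k V x|)
    (hδ : cR * Cop / r₀ + Λb * Cm = δ) (hrA : M.RepresentsA EA W) (hrB : M.RepresentsB EB W) (hbase : M.InBase EB W)
    (hlip : M.DataLipschitz W κ Λ ρ₀) (hdA : DecayBound EA W EA₀ κ) (hdB : DecayBound EB W E₀ κ)
    (hreadI : (InsOpModel.ofStep M Ins).ReadsIns W) (hienv : (InsOpModel.ofStep M Ins).InsOpEnvelope W κ E₀ Gi)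
    (hbdA : (InsOpModel.ofStep M Ins).InsBoundA W κ E₀ Gi) (hGi : 0 ≤ Gi) (hdamp : M.InsertionDampedNat W κ c ω)
    (hΛ : 0 ≤ Λ) (hθ0 : 0 < θ) (hθ1 : θ < 1) (hθθ' : θ ≤ θ') (hθ'1 : θ' ≤ 1) (hc : 0 ≤ c) (hω : 0 < ω)
    (hreachρ : c * (EA₀ + E₀) / (1 - ω) < ρ₀) (hsmall : ω + Λ * c < θ') : ∃ C₅, NE5 EA EB W κ θ' C₅ := by
  obtain ⟨k₁, hk₁⟩ := insReach_exists_any (δ := δ) hθ1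
  obtain ⟨k₀, B, hB, hnear, hfirst⟩ :=
    reach_binders_exists_any (D := δ + (Gi * δ / (1 - 1 / 2) + 2 * Gi / θ ^ k₁)) hθ0 hθ1 hreachρ
  exact ⟨_, ne5_at_of_towerLaw_split_readsIns_nat M Ins opMid dist R hr hA hlaw hread hcR hCop hθ₂ hθ₂θ hfl hr₀ hLip hΛb
    hR hCm hdom hδ hrA hrB hbase hlip hdA hdB hreadI hienv hbdA hGi (by norm_num) hk₁ hdamp hΛ hθ0 hθθ' hθ'1 hc hω hnear hB
    hfirst hsmall⟩

/-- [folklore] **BOTH ARITHMETIC LEAVES DISCHARGED TO ROOM ON THE TOWER-READING ROAD**: the minimiser-split socket END with the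
letters eliminated AND the smallness `ω + Λ·c < θ′` replaced by the room `ω + Λ·c < 1` — SOME rate `θ′ ∈ [θ, 1)` and constant
with NE5 (`OutputRateArithmetic.rate_window_iff` BY NAME).  NOT a proof of NE5. -/
theorem exists_rate_ne5_of_towerLaw_split_readsIns_nat (Ins : ℕ → Op → (C.Dom → ℝ) → Hist)
    {A : (j : J) → (k : ℕ) → Matrix (ι j k) (ι j (k + 1)) ℂ} {X : (j : J) → (k : ℕ) → Matrix (ι j k) (ι j k) ℂ}
    {r Cop θ₂ cR r₀ Λb Cm δ : ℝ} {tow : ℕ → (ℕ → ℝ) → C.BgB → J} (opMid : (ℕ → ℝ) → C.BgB → ℕ → Op)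
    (dist : ℕ → (ℕ → ℝ) → C.BgB → ℝ) {ιR XR : Type*} (R : Readings ιR XR) {EA : Functional C C.BgA}
    {EB : Functional C C.BgB} {W : Set (ℕ → ℝ)} {κ Λ EA₀ E₀ Gi θ c ω ρ₀ : ℝ} (hr : 0 < r)
    (hA : TowerContracting A r) (hlaw : TowerLaw A X r Cop θ₂) (hread : ReadsTowerMid M A X r W cR tow opMid)
    (hcR : 0 ≤ cR) (hCop : 0 ≤ Cop) (hθ₂ : 0 ≤ θ₂) (hθ₂θ : θ₂ ≤ θ) (hfl : ∀ k, r₀ ≤ M.rOp k) (hr₀ : 0 < r₀)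
    (hLip : ∀ k, ∀ g ∈ W, ∀ (U : C.BgB), ‖opMid g U k - M.opB g U k‖ ≤ Λb * dist k g U * M.rOp k) (hΛb : 0 ≤ Λb)
    (hR : LocalRate R Cm θ) (hCm : 0 ≤ Cm)
    (hdom : ∀ k, ∀ g ∈ W, ∀ (U : C.BgB), ∃ V ∈ R.dom, ∃ x : XR, dist k g U ≤ |R.loc (k + 1) V x - R.loc k V x|)
    (hδ : cR * Cop / r₀ + Λb * Cm = δ) (hrA : M.RepresentsA EA W) (hrB : M.RepresentsB EB W) (hbase : M.InBase EB W)
    (hlip : M.DataLipschitz W κ Λ ρ₀) (hdA : DecayBound EA W EA₀ κ) (hdB : DecayBound EB W E₀ κ)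
    (hreadI : (InsOpModel.ofStep M Ins).ReadsIns W) (hienv : (InsOpModel.ofStep M Ins).InsOpEnvelope W κ E₀ Gi)
    (hbdA : (InsOpModel.ofStep M Ins).InsBoundA W κ E₀ Gi) (hGi : 0 ≤ Gi) (hdamp : M.InsertionDampedNat W κ c ω)
    (hΛ : 0 ≤ Λ) (hθ0 : 0 < θ) (hθ1 : θ < 1) (hc : 0 ≤ c) (hω : 0 < ω) (hreachρ : c * (EA₀ + E₀) / (1 - ω) < ρ₀)
    (hroom : ω + Λ * c < 1) : ∃ θ', θ ≤ θ' ∧ θ' < 1 ∧ ∃ C₅, NE5 EA EB W κ θ' C₅ := by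
  obtain ⟨θ', hθθ', hθ'1, hsmall⟩ := rate_window_iff.mpr ⟨hθ1, hroom⟩
  exact ⟨θ', hθθ', hθ'1, exists_ne5_at_of_towerLaw_split_readsIns_nat M Ins opMid dist R hr hA hlaw hread hcR hCop hθ₂
    hθ₂θ hfl hr₀ hLip hΛb hR hCm hdom hδ hrA hrB hbase hlip hdA hdB hreadI hienv hbdA hGi hdamp hΛ hθ0 hθ1 hθθ' hθ'1.le hc
    hω hreachρ hsmall⟩

end Socket

/-! ## §2 The `∃ C₅`-OUTERMOST face: one constant from the sizes, for every carrier, model, tower family, reading and window -/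

section Uniform

/-- [folklore] **NE5 ON THE TOWER-READING ROAD WITH ONE CONSTANT FROM THE SIZES, ARITHMETIC LETTERS ELIMINATED.**  Fix the SIZES
`κ, Λ ≥ 0, ρ₀, EA₀, E₀, Gi ≥ 0, δ, c ≥ 0, ω > 0`, the input rate `0 < θ < 1` and the target `θ ≤ θ′ ≤ 1`, subject to the strict reach
`c(EA₀ + E₀)/(1 − ω) < ρ₀` and the smallness `ω + Λ·c < θ′`.  Then ONE `C₅` serves EVERY carrier structure, operator∕history spaces,
step model, insertion, tower family over ANY index type (contracting, row NE2's `TowerLaw … Cop θ₂`, `θ₂ ≤ θ`), reading `ReadsTowerMid`,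
floor, background-Lipschitz datum, `Readings` carrier with row NE3's `LocalRate R Cm θ` and domination, with W1's constant pinned to the
size (`cR·Cop/r₀ + Λb·Cm = δ`) and every other displayed binder of `OutputRateTowerSocket.ne5_at_of_towerLaw_split_readsIns_nat` at those
sizes.  The uniformity is the quantifier order `∃ C₅, ∀ …` (`k₁, k₀, B` are chosen from the sizes alone, §0).  NOT a proof of NE5. -/
theorem uniform_ne5_of_towerLaw_split_readsIns {κ Λ ρ₀ EA₀ E₀ Gi δ c ω θ θ' : ℝ} (hGi : 0 ≤ Gi) (hΛ : 0 ≤ Λ)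
    (hθ0 : 0 < θ) (hθ1 : θ < 1) (hθθ' : θ ≤ θ') (hθ'1 : θ' ≤ 1) (hc : 0 ≤ c) (hω : 0 < ω)
    (hreachρ : c * (EA₀ + E₀) / (1 - ω) < ρ₀) (hsmall : ω + Λ * c < θ') :
    ∃ C₅ : ℝ, ∀ {J : Type*} {ι : J → ℕ → Type*} [∀ j k, Fintype (ι j k)] [∀ j k, DecidableEq (ι j k)]
      {C : Carriers} {Op Hist : Type*} [NormedAddCommGroup Op] [NormedSpace ℂ Op] [NormedAddCommGroup Hist]
      [NormedSpace ℂ Hist] [CompleteSpace Hist] (M : StepModel C Op Hist) (Ins : ℕ → Op → (C.Dom → ℝ) → Hist)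
      {A : (j : J) → (k : ℕ) → Matrix (ι j k) (ι j (k + 1)) ℂ} {X : (j : J) → (k : ℕ) → Matrix (ι j k) (ι j k) ℂ}
      {r Cop θ₂ cR r₀ Λb Cm : ℝ} {tow : ℕ → (ℕ → ℝ) → C.BgB → J} (opMid : (ℕ → ℝ) → C.BgB → ℕ → Op)
      (dist : ℕ → (ℕ → ℝ) → C.BgB → ℝ) {ιR XR : Type*} (R : Readings ιR XR) {EA : Functional C C.BgA}
      {EB : Functional C C.BgB} {W : Set (ℕ → ℝ)},
      0 < r → TowerContracting A r → TowerLaw A X r Cop θ₂ → ReadsTowerMid M A X r W cR tow opMid → 0 ≤ cR → 0 ≤ Cop →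
      0 ≤ θ₂ → θ₂ ≤ θ → (∀ k, r₀ ≤ M.rOp k) → 0 < r₀ →
      (∀ k, ∀ g ∈ W, ∀ (U : C.BgB), ‖opMid g U k - M.opB g U k‖ ≤ Λb * dist k g U * M.rOp k) → 0 ≤ Λb →
      LocalRate R Cm θ → 0 ≤ Cm →
      (∀ k, ∀ g ∈ W, ∀ (U : C.BgB), ∃ V ∈ R.dom, ∃ x : XR, dist k g U ≤ |R.loc (k + 1) V x - R.loc k V x|) →
      cR * Cop / r₀ + Λb * Cm = δ → M.RepresentsA EA W → M.RepresentsB EB W → M.InBase EB W →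
      M.DataLipschitz W κ Λ ρ₀ → DecayBound EA W EA₀ κ → DecayBound EB W E₀ κ →
      (InsOpModel.ofStep M Ins).ReadsIns W → (InsOpModel.ofStep M Ins).InsOpEnvelope W κ E₀ Gi →
      (InsOpModel.ofStep M Ins).InsBoundA W κ E₀ Gi → M.InsertionDampedNat W κ c ω →
      NE5 EA EB W κ θ' C₅ := by
  obtain ⟨k₁, hk₁⟩ := insReach_exists_any (δ := δ) hθ1
  obtain ⟨k₀, B, hB, hnear, hfirst⟩ :=
    reach_binders_exists_any (D := δ + (Gi * δ / (1 - 1 / 2) + 2 * Gi / θ ^ k₁)) hθ0 hθ1 hreachρ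
  refine ⟨(Λ * (δ + (Gi * δ / (1 - 1 / 2) + 2 * Gi / θ ^ k₁)) + B) * (θ' - ω) / (θ' - (ω + Λ * c)), ?_⟩
  intro J ι _ _ C Op Hist _ _ _ _ _ M Ins A X r Cop θ₂ cR r₀ Λb Cm tow opMid dist ιR XR R EA EB W hr hA hlaw hread hcR hCop
    hθ₂ hθ₂θ hfl hr₀ hLip hΛb hR hCm hdom hδ hrA hrB hbase hlip hdA hdB hreadI hienv hbdA hdamp
  exact ne5_at_of_towerLaw_split_readsIns_nat M Ins opMid dist R hr hA hlaw hread hcR hCop hθ₂ hθ₂θ hfl hr₀ hLip hΛb hR hCm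
    hdom hδ hrA hrB hbase hlip hdA hdB hreadI hienv hbdA hGi (by norm_num) hk₁ hdamp hΛ hθ0 hθθ' hθ'1 hc hω hnear hB hfirst
    hsmall

end Uniform

/-! ## §3 The INSTANCES: row NE2's perturbed free towers; Bałaban's typed tier-B operator (rate `L⁻¹`; and at NE3's honest rate) -/

section Perturbed

variable {ι : ℕ → Type*} [∀ k, Fintype (ι k)] [∀ k, DecidableEq (ι k)]
variable {Jx : Type*} {D : (k : ℕ) → Matrix (ι k) (ι k) ℂ} {A : (k : ℕ) → Matrix (ι k) (ι (k + 1)) ℂ}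
  {Jinj : (k : ℕ) → Matrix (ι (k + 1)) (ι k) ℂ} {F : (k : ℕ) → Matrix (ι k) (ι k) ℂ} {r κP : ℝ} {e₀ e₁ f : ℕ → ℝ}
  {e₂ : Jx → ℕ → ℝ} {P : Jx → (k : ℕ) → Matrix (ι k) (ι k) ℂ} {C₀ C₁ C₂ Cf : ℝ} {t : ℂ}
variable {C : Carriers} {Op Hist : Type*} [NormedAddCommGroup Op] [NormedSpace ℂ Op] [NormedAddCommGroup Hist]
  [NormedSpace ℂ Hist] [CompleteSpace Hist] (M : StepModel C Op Hist)

/-- [folklore] **THE TOWER END OF RECORD, ARITHMETIC LETTERS ELIMINATED** — `OutputRateTowerInstance.ne5_at_of_perturbed_split_readsIns_nat`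
(W1's first leg := row NE2's perturbed-tower instance: `FreeTowerLaws` (U = 1, a theorem for Bałaban's `Δ_a`) + PER INDEX the typed
`PerturbationLaws` (NOT IN PRINT for `Δ_a(U) − Δ_a`), geometric defects, `‖t‖κP < 1`; second leg := background-Lipschitz × row NE3's
`LocalRate`; W4 produced; `hδ : cR·Cpert(t)/r₀ + Λb·Cm = δ`) with `k₀, B, k₁, ρ₁` and their five binders REPLACED by `0 < θ < 1` and
`c(EA₀ + E₀)/(1 − ω) < ρ₀` — §1 with the instance's `towerContracting_perturbed` ∕ `towerLaw_perturbed` ∕ `Cpert_nonneg` BY NAME.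
NOT a proof of NE5. -/
theorem exists_ne5_at_of_perturbed_split_readsIns_nat (Ins : ℕ → Op → (C.Dom → ℝ) → Hist) {W : Set (ℕ → ℝ)}
    {cR r₀ Λb Cm δ θ₂ : ℝ} {tow : ℕ → (ℕ → ℝ) → C.BgB → Jx} (opMid : (ℕ → ℝ) → C.BgB → ℕ → Op)
    (dist : ℕ → (ℕ → ℝ) → C.BgB → ℝ) {ιR XR : Type*} (R : Readings ιR XR) {EA : Functional C C.BgA}
    {EB : Functional C C.BgB} {κ Λ EA₀ E₀ Gi θ θ' c ω ρ₀ : ℝ} (hr : 0 < r)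
    (hfree : FreeTowerLaws D A Jinj F r e₀ e₁ f) (hpert : ∀ j, PerturbationLaws D (P j) Jinj κP (e₂ j))
    (h₀ : ∀ k, e₀ k ≤ C₀ * θ₂ ^ k) (h₁ : ∀ k, e₁ k ≤ C₁ * θ₂ ^ k) (h₂ : ∀ j k, e₂ j k ≤ C₂ * θ₂ ^ k)
    (hf : ∀ k, f k ≤ Cf * θ₂ ^ k) (hC₀ : 0 ≤ C₀) (hC₁ : 0 ≤ C₁) (hC₂ : 0 ≤ C₂) (hCf : 0 ≤ Cf) (ht : ‖t‖ * κP < 1)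
    (hread : ReadsTowerMid M (fun _ : Jx => A) (pertTower D P t) r W cR tow opMid) (hcR : 0 ≤ cR) (hθ₂ : 0 ≤ θ₂)
    (hθ₂θ : θ₂ ≤ θ) (hfl : ∀ k, r₀ ≤ M.rOp k) (hr₀ : 0 < r₀)
    (hLip : ∀ k, ∀ g ∈ W, ∀ (U : C.BgB), ‖opMid g U k - M.opB g U k‖ ≤ Λb * dist k g U * M.rOp k) (hΛb : 0 ≤ Λb)
    (hR : LocalRate R Cm θ) (hCm : 0 ≤ Cm)
    (hdom : ∀ k, ∀ g ∈ W, ∀ (U : C.BgB), ∃ V ∈ R.dom, ∃ x : XR, dist k g U ≤ |R.loc (k + 1) V x - R.loc k V x|)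
    (hδ : cR * Cpert κP C₀ C₁ C₂ Cf t / r₀ + Λb * Cm = δ) (hrA : M.RepresentsA EA W) (hrB : M.RepresentsB EB W)
    (hbase : M.InBase EB W) (hlip : M.DataLipschitz W κ Λ ρ₀) (hdA : DecayBound EA W EA₀ κ) (hdB : DecayBound EB W E₀ κ)
    (hreadI : (InsOpModel.ofStep M Ins).ReadsIns W) (hienv : (InsOpModel.ofStep M Ins).InsOpEnvelope W κ E₀ Gi)
    (hbdA : (InsOpModel.ofStep M Ins).InsBoundA W κ E₀ Gi) (hGi : 0 ≤ Gi) (hdamp : M.InsertionDampedNat W κ c ω)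
    (hΛ : 0 ≤ Λ) (hθ0 : 0 < θ) (hθ1 : θ < 1) (hθθ' : θ ≤ θ') (hθ'1 : θ' ≤ 1) (hc : 0 ≤ c) (hω : 0 < ω)
    (hreachρ : c * (EA₀ + E₀) / (1 - ω) < ρ₀) (hsmall : ω + Λ * c < θ') : ∃ C₅, NE5 EA EB W κ θ' C₅ :=
  exists_ne5_at_of_towerLaw_split_readsIns_nat M Ins opMid dist R hr (towerContracting_perturbed hfree)
    (towerLaw_perturbed hr hfree hpert h₀ h₁ h₂ hf ht) hread hcR (Cpert_nonneg ht hC₀ hC₁ hC₂ hCf) hθ₂ hθ₂θ hfl hr₀ hLip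
    hΛb hR hCm hdom hδ hrA hrB hbase hlip hdA hdB hreadI hienv hbdA hGi hdamp hΛ hθ0 hθ1 hθθ' hθ'1 hc hω hreachρ hsmall

end Perturbed

section Balaban

open Literature.MathematicalPhysics.QuantumFieldTheory.Balaban1983to89.B5Prop11Plancherel (Cst Tor fine)
open Literature.MathematicalPhysics.QuantumFieldTheory.Balaban1983to89.B5G183RateUnitTower (lev lev_neZero)
open Summit.QuantumFields.BalabanUV.T4Continuum.BalabanAveragedTowerUnit (idx Qlev)
open Summit.QuantumFields.BalabanUV.T4Continuum.KingPairingPlantedLaw (calDalev CJ)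
open Summit.QuantumFields.BalabanUV.T4Continuum.GramPerturbationLaw (C2gram)
open Summit.QuantumFields.BalabanUV.T4Continuum.NE2FromNE3 (bgReadings)
open Summit.QuantumFields.BalabanUV.T4Continuum.RegularBackgroundTower (RegularTransporters regClass betaNE3)
open Summit.QuantumFields.BalabanUV.T4Continuum.GaugeTermScalarData (QuT Q1)
open Summit.QuantumFields.BalabanUV.T4Continuum.RegularSiteTransporters (siteT)
open Summit.QuantumFields.BalabanUV.T4Continuum.NestedContourTransport (theta0)
open Summit.QuantumFields.BalabanUV.T4Continuum.NE2BalabanRoot (balabanPert)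
open Summit.QuantumFields.BalabanUV.T4Continuum.NE2BalabanGauge (gaugeSlot liftR)
open Summit.QuantumFields.BalabanUV.T4Continuum.NE2BalabanLayerSharp (kappaBs C2Bs)
open Summit.QuantumFields.BalabanUV.T4Continuum.NE2BalabanWiring (epsR CdeltaR)
open Summit.QuantumFields.BalabanUV.T4Continuum.NE2BalabanFinal (kappa4F C4F)
open Summit.QuantumFields.BalabanUV.T4Continuum.NE2BalabanThreshold (etaStar)
open Summit.QuantumFields.BalabanUV.T4Continuum.NE2FromNE3Carrier (ne2Loc)
open Summit.QuantumFields.BalabanUV.T4Continuum.MinimalActionRate (minActReadings)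
open Summit.QuantumFields.BalabanUV.T4Continuum.OutputRateTowerBalabanRate

variable {d : ℕ} (L : ℕ) [NeZero L] (Mf : Fin d → ℕ) [∀ μ, NeZero (Mf μ)] (a : ℝ) (ha : 0 < a)
variable {o : Type*} [Fintype o] [DecidableEq o]
variable {Jx : Type*} {Rg : Jx → ((k : ℕ) → Fin d → (Tor (fine (lev L k) Mf) → Matrix o o ℂ))} {α β Cn a' η : ℝ}
variable {Cr : Carriers} {Op Hist : Type*} [NormedAddCommGroup Op] [NormedSpace ℂ Op] [NormedAddCommGroup Hist]
  [NormedSpace ℂ Hist] [CompleteSpace Hist] (Mdl : StepModel Cr Op Hist)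

/-- [folklore] **ROW NE5's END FOR BAŁABAN's TYPED TIER-B OPERATOR, ARITHMETIC LETTERS ELIMINATED** —
`OutputRateTowerBalaban.ne5_at_of_balaban_lip_readsIns_nat` (W1 := `towerLaw_balaban_final_of_regular`: a nonempty family `Rg j` of
site-based transporter towers (DATA) in row B5's class with sizes `α, β ≤ η ≤ etaStar o d a a′`, node NE3's `LocalRate … C L⁻¹` per
member (OPEN, displayed), `a′ > 0`; W1's constant `δ = cR·Cpert(κ_B, 2dCst, CJ, C₂^B, 0, 1)/r₀` abbreviated by `hδ`; rate `L⁻¹`; W4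
produced) with `k₀, Bc, k₁, ρ₁` and their five binders REPLACED by `1 < L` (so that `0 < L⁻¹ < 1`; the printed form has
«L odd > 11») and the strict reach `c(EA₀ + E₀)/(1 − ω) < ρ₀`.  Model level (no B0); NE5 / NE2 / NE3 NOT proved. -/
theorem exists_ne5_at_of_balaban_lip_readsIns_nat (Ins : ℕ → Op → (Cr.Dom → ℝ) → Hist) (hL1 : 1 < L) (hJ : Nonempty Jx)
    (hd : 1 ≤ d) (hreg : ∀ j, RegularTransporters L Mf (liftR L Mf (Rg j)) α β) (hα : 0 ≤ α) (hβ : 0 ≤ β) (hC : 0 ≤ Cn)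
    (hNE3 : ∀ j, LocalRate (bgReadings L Mf (regClass L Mf (liftR L Mf (Rg j)))) Cn ((L : ℝ)⁻¹)) (ha' : 0 < a')
    (hαη : α ≤ η) (hβη : β ≤ η) (hη : η ≤ etaStar o d a a')
    {W : Set (ℕ → ℝ)} {cR r₀ δ : ℝ} {tow : ℕ → (ℕ → ℝ) → Cr.BgB → Jx} {EA : Functional Cr Cr.BgA} {EB : Functional Cr Cr.BgB}
    {κ Λ EA₀ E₀ Gi θ' c ω ρ₀ : ℝ}
    (hread : ReadsTower Mdl (fun _ : Jx => fun k => Qlev L Mf k ⊗ₖ (1 : Matrix o o ℂ))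
      (pertTower (fun k => calDalev L Mf a ha k ⊗ₖ (1 : Matrix o o ℂ))
        (fun j => balabanPert L Mf a (liftR L Mf (Rg j)) (gaugeSlot L Mf (Rg j) (QuT L Mf o (siteT L Mf (Rg j))) (Q1 L Mf o) a'))
        1)
      ((L : ℝ) ^ d) W cR tow)
    (hcR : 0 ≤ cR) (hfl : ∀ k, r₀ ≤ Mdl.rOp k) (hr₀ : 0 < r₀)
    (hδ : cR * Cpert (kappaBs o d a α β (a * (epsR o d α * (2 + epsR o d α) * Cst d a)) (kappa4F d a a' α β))
        (2 * d * Cst d a) (CJ d a)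
        (C2Bs o d L a α β Cn
          (a * C2gram (Cst d a) 1 (epsR o d α) (2 * d * Cst d a) (CJ d a) (Cst d a) (CdeltaR o d a α (theta0 d α (betaNE3 o Cn))))
          (C4F o d L a a' α β Cn)) 0 1 / r₀ = δ)
    (hrA : Mdl.RepresentsA EA W) (hrB : Mdl.RepresentsB EB W) (hbase : Mdl.InBase EB W) (hlip : Mdl.DataLipschitz W κ Λ ρ₀)
    (hdA : DecayBound EA W EA₀ κ) (hdB : DecayBound EB W E₀ κ) (hreadI : (InsOpModel.ofStep Mdl Ins).ReadsIns W)
    (hienv : (InsOpModel.ofStep Mdl Ins).InsOpEnvelope W κ E₀ Gi) (hbdA : (InsOpModel.ofStep Mdl Ins).InsBoundA W κ E₀ Gi)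
    (hGi : 0 ≤ Gi) (hdamp : Mdl.InsertionDampedNat W κ c ω) (hΛ : 0 ≤ Λ) (hθθ' : (L : ℝ)⁻¹ ≤ θ') (hθ'1 : θ' ≤ 1)
    (hc : 0 ≤ c) (hω : 0 < ω) (hreachρ : c * (EA₀ + E₀) / (1 - ω) < ρ₀) (hsmall : ω + Λ * c < θ') :
    ∃ C₅, NE5 EA EB W κ θ' C₅ := by
  have hL : (1 : ℝ) < L := by exact_mod_cast hL1
  have hθ0 : (0 : ℝ) < (L : ℝ)⁻¹ := inv_pos.mpr (by linarith)
  have hθ1 : (L : ℝ)⁻¹ < 1 := inv_lt_one_of_one_lt₀ hL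
  obtain ⟨k₁, hk₁⟩ := insReach_exists_any (δ := δ) hθ1
  obtain ⟨k₀, Bc, hBc, hnear, hfirst⟩ :=
    reach_binders_exists_any (D := δ + (Gi * δ / (1 - 1 / 2) + 2 * Gi / ((L : ℝ)⁻¹) ^ k₁)) hθ0 hθ1 hreachρ
  exact ⟨_, ne5_at_of_balaban_lip_readsIns_nat L Mf a ha Mdl Ins hJ hd hreg hα hβ hC hNE3 ha' hαη hβη hη hread hcR hfl hr₀
    hδ hrA hrB hbase hlip hdA hdB hreadI hienv hbdA hGi (by norm_num) hk₁ hdamp hΛ hθθ' hθ'1 hc hω hnear hBc hfirst hsmall⟩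

variable {𝒞 : ℕ → Set (B7Prop1Explicit.Site d → Fin d → (Matrix o o ℂ)ˣ)} {N : ℕ}
  {dom : Set (B7Prop1Explicit.Site d → Fin d → (Matrix o o ℂ)ˣ)}
  {Rd : (B7Prop1Explicit.Site d → Fin d → (Matrix o o ℂ)ˣ) → ((k : ℕ) → Fin d → (Tor (fine (lev L k) Mf) → Matrix o o ℂ))} {θ : ℝ}

/-- [folklore] **ROW NE5's END FOR BAŁABAN's TYPED TIER-B OPERATOR BY THE MINIMISER SPLIT AT NODE NE3's HONEST RATE, ARITHMETIC LETTERS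
ELIMINATED** — the owner's `OutputRateTowerBalabanRate.ne5_at_of_balaban_split_readsIns_ne3Shape_nat` (`d ≥ 1`, `dom` nonempty; W1 :=
PART 5's tower law on the pair (run A, `opMid`) + background-Lipschitz × the minimiser distance, BOTH fed by node U1b's FULL registered shape
`NE3Shape (minActReadings d 𝒞 L N dom (ne2Loc …)) C θ` — NO rate binder, NO NE2 binder left; W1's constant abbreviated by `hδ`; rate
`max θ L⁻¹`; W4 produced) with `k₀, Bc, k₁, ρ₁` and their five binders REPLACED by `1 < L` (with `NE3Shape.rate_lt_one`:
`0 < max θ L⁻¹ < 1`) and the strict reach `c(EA₀ + E₀)/(1 − ω) < ρ₀`.  `Rd` DATA (no B0); NE5 / NE2 / NE3 NOT proved. -/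
theorem exists_ne5_at_of_balaban_split_readsIns_ne3Shape_nat (Ins : ℕ → Op → (Cr.Dom → ℝ) → Hist) (hL1 : 1 < L)
    (hne : dom.Nonempty) (hd : 1 ≤ d) (hreg : ∀ V ∈ dom, RegularTransporters L Mf (liftR L Mf (Rd V)) α β) (hα : 0 ≤ α)
    (hβ : 0 ≤ β) (hC : 0 ≤ Cn) (hNE3 : NE3Shape (minActReadings d 𝒞 L N dom (ne2Loc L Mf fun V => liftR L Mf (Rd V))) Cn θ)
    (ha' : 0 < a') (hαη : α ≤ η) (hβη : β ≤ η) (hη : η ≤ etaStar o d a a')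
    {W : Set (ℕ → ℝ)} {cR r₀ Λb δ : ℝ} {tow : ℕ → (ℕ → ℝ) → Cr.BgB → ↥dom} (opMid : (ℕ → ℝ) → Cr.BgB → ℕ → Op)
    (dist : ℕ → (ℕ → ℝ) → Cr.BgB → ℝ) {EA : Functional Cr Cr.BgA} {EB : Functional Cr Cr.BgB} {κ Λ EA₀ E₀ Gi θ' c ω ρ₀ : ℝ}
    (hread : ReadsTowerMid Mdl (fun _ : ↥dom => fun k => Qlev L Mf k ⊗ₖ (1 : Matrix o o ℂ))
      (pertTower (fun k => calDalev L Mf a ha k ⊗ₖ (1 : Matrix o o ℂ))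
        (fun V : ↥dom => balabanPert L Mf a (liftR L Mf (Rd V)) (gaugeSlot L Mf (Rd V) (QuT L Mf o (siteT L Mf (Rd V))) (Q1 L Mf o) a'))
        1)
      ((L : ℝ) ^ d) W cR tow opMid)
    (hcR : 0 ≤ cR) (hfl : ∀ k, r₀ ≤ Mdl.rOp k) (hr₀ : 0 < r₀)
    (hLip : ∀ k, ∀ g ∈ W, ∀ (U : Cr.BgB), ‖opMid g U k - Mdl.opB g U k‖ ≤ Λb * dist k g U * Mdl.rOp k) (hΛb : 0 ≤ Λb)
    (hdom : ∀ k, ∀ g ∈ W, ∀ (U : Cr.BgB), ∃ V ∈ dom, ∃ x : Bool × NE2FromNE3.Site L Mf o,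
      dist k g U ≤ |ne2Loc L Mf (fun V => liftR L Mf (Rd V)) (k + 1) V x - ne2Loc L Mf (fun V => liftR L Mf (Rd V)) k V x|)
    (hδ : cR * Cpert (kappaBs o d a α β (a * (epsR o d α * (2 + epsR o d α) * Cst d a)) (kappa4F d a a' α β))
        (2 * d * Cst d a) (CJ d a)
        (C2Bs o d L a α β Cn
          (a * C2gram (Cst d a) 1 (epsR o d α) (2 * d * Cst d a) (CJ d a) (Cst d a) (CdeltaR o d a α (theta0 d α (betaNE3 o Cn))))
          (C4F o d L a a' α β Cn)) 0 1 / r₀ + Λb * Cn = δ)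
    (hrA : Mdl.RepresentsA EA W) (hrB : Mdl.RepresentsB EB W) (hbase : Mdl.InBase EB W) (hlip : Mdl.DataLipschitz W κ Λ ρ₀)
    (hdA : DecayBound EA W EA₀ κ) (hdB : DecayBound EB W E₀ κ) (hreadI : (InsOpModel.ofStep Mdl Ins).ReadsIns W)
    (hienv : (InsOpModel.ofStep Mdl Ins).InsOpEnvelope W κ E₀ Gi) (hbdA : (InsOpModel.ofStep Mdl Ins).InsBoundA W κ E₀ Gi)
    (hGi : 0 ≤ Gi) (hdamp : Mdl.InsertionDampedNat W κ c ω) (hΛ : 0 ≤ Λ) (hθθ' : max θ ((L : ℝ)⁻¹) ≤ θ') (hθ'1 : θ' ≤ 1)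
    (hc : 0 ≤ c) (hω : 0 < ω) (hreachρ : c * (EA₀ + E₀) / (1 - ω) < ρ₀) (hsmall : ω + Λ * c < θ') :
    ∃ C₅, NE5 EA EB W κ θ' C₅ := by
  have hL : (1 : ℝ) < L := by exact_mod_cast hL1
  have hθ0 : (0 : ℝ) < max θ ((L : ℝ)⁻¹) := lt_max_of_lt_right (inv_pos.mpr (by linarith))
  have hθ1 : max θ ((L : ℝ)⁻¹) < 1 := max_lt hNE3.rate_lt_one (inv_lt_one_of_one_lt₀ hL)
  obtain ⟨k₁, hk₁⟩ := insReach_exists_any (δ := δ) hθ1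
  obtain ⟨k₀, Bc, hBc, hnear, hfirst⟩ :=
    reach_binders_exists_any (D := δ + (Gi * δ / (1 - 1 / 2) + 2 * Gi / (max θ ((L : ℝ)⁻¹)) ^ k₁)) hθ0 hθ1 hreachρ
  exact ⟨_, ne5_at_of_balaban_split_readsIns_ne3Shape_nat L Mf a ha Mdl Ins hne hd hreg hα hβ hC hNE3 ha' hαη hβη hη opMid dist
    hread hcR hfl hr₀ hLip hΛb hdom hδ hrA hrB hbase hlip hdA hdB hreadI hienv hbdA hGi (by norm_num) hk₁ hdamp hΛ hθθ' hθ'1 hc hω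
    hnear hBc hfirst hsmall⟩

end Balaban

end Summit.QuantumFields.BalabanUV.T4Continuum.OutputRateTowerArithmetic

end
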